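import Summits.Ventures.DiscreteObjects.Hadamard.IsometryCodeParity
import Summits.Ventures.DiscreteObjects.Hadamard.HadamardCodeModQ
import Summits.Ventures.DiscreteObjects.Hadamard.HadamardParity668

/-!
# Even multiplicity of self-conjugate cyclotomic factors in every signed automorphism of a Hadamard matrix, mod `q ∥ n` (kernel)

Framing: lottery ticket; floor = certified bounds/negative ranges.

Cell pub-namedobj (venture DiscreteObjects), target (H), hadamard gen 15.  LANDER'S METHOD AT THE MATRIX LEVEL.  Let `H` be an
integer matrix with `H Hᵀ = n·1` (every Hadamard matrix of order `n`), `q` a prime with `q ∣ n`, `q² ∤ n` (at `n = 668`: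
`q = 167`; every order `4q`, `q` odd prime, qualifies with its own `q`), and `(π, κ, d, e)` a signed automorphism
(`H (π i) (κ j) = d i e j H i j`).  Let `Kt` be the column pull-back `(Kt v) j = e j v (κ j)` over `𝔽_q` and suppose `κ^M = 1`
pointwise with `q ∤ 2M`.  Then for every irreducible `h ∈ 𝔽_q[X]` dividing `X^{2M} - 1` that is SELF-RECIPROCAL
(`h ∣ h(X^{2M-1})`):
**`hadamard_signedAut_even_multiplicity_col`**: `2 · deg h ∣ dim ker h(Kt)` — the multiplicity of `h` in the signed permutation
`(κ, e)` is EVEN; dually for rows (`_row`, with `(π, d)`).  Self-reciprocity holds for every irreducible factor of `X^m - 1`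
as soon as `q^j ≡ -1 (mod m)` for some `j` (`dvd_comp_X_pow_of_selfConj_mod`, Frobenius argument of gen 8 for general `m`),
whence the packaged form **`hadamard_signedAut_even_multiplicity`** (hypotheses `m ∣ 2M`, `q^j % m = m - 1`, `h ∣ X^m - 1`).
At `q = 167` the admissible `m ≤ 44` include `1, 2, 3, 4, 5, 6, 7, 8, 9, 10, 11, 12, 13, 14, 18, 21, 22, 24, 26, 28, 33, 37, 41, 42, 44`.
Proof = `HadamardCodeModQ` (the code `ker H̄` is self-dual and `Kt`-invariant; `Kt` is an isometry with `Kt^{2M} = 1`) +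
`IsometryCodeParity` (Lander 1983 Prop. 3.18).  The cycle-count reading of `dim ker h(Kt)` and the H(668) corollaries are in
the sequel files.  Ours; no `sorry`; references [cite: book:lander1983-symmetric-designs-algebraic-approach, Prop 3.18 p.94].
-/

open Polynomial Finset BigOperators Matrix

namespace Summit.Ventures.DiscreteObjects.Hadamard

section selfreciprocal
variable {q : ℕ} [Fact (Nat.Prime q)]

/-- `X^m - 1 ∣ X^N - 1` when `m ∣ N` -/
lemma X_pow_sub_one_dvd_of_dvd {R : Type*} [CommRing R] {m N : ℕ} (hmN : m ∣ N) :
    (X ^ m - 1 : R[X]) ∣ X ^ N - 1 := by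
  obtain ⟨k, rfl⟩ := hmN
  have e := sub_dvd_pow_sub_pow (X ^ m : R[X]) 1 k
  rwa [one_pow, ← pow_mul] at e

/-- **Self-reciprocity from self-conjugacy.**  If `q^j ≡ -1 (mod m)` then every irreducible factor `h` of `X^m - 1` over
`𝔽_q` divides `h(X^{N-1})` for every `N > 0` with `m ∣ N` (the root `α` of `h` has `α^{N-1} = α⁻¹ = α^{q^j} = Frob^j α`). -/
theorem dvd_comp_X_pow_of_selfConj_mod {m N j : ℕ} (hmN : m ∣ N) (hN : 0 < N) (hj : q ^ j % m = m - 1)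
    {h : (ZMod q)[X]} (hirr : Irreducible h) (hdvd : h ∣ X ^ m - 1) : h ∣ h.comp (X ^ (N - 1)) := by
  haveI : Fact (Irreducible h) := ⟨hirr⟩
  have hm : 0 < m := by
    rcases Nat.eq_zero_or_pos m with rfl | hm
    · rw [zero_dvd_iff] at hmN; omega
    · exact hm
  set K := AdjoinRoot h with hK
  set α : K := AdjoinRoot.root h with hα
  -- α^m = 1
  have hαm : α ^ m = 1 := by
    obtain ⟨g, hg⟩ := hdvd
    have e : aeval α (X ^ m - 1 : (ZMod q)[X]) = 0 := by
      rw [hg, map_mul, AdjoinRoot.aeval_eq, AdjoinRoot.mk_self, zero_mul]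
    rw [map_sub, map_pow, aeval_X, map_one, sub_eq_zero] at e
    exact e
  have hα0 : α ≠ 0 := by
    intro h0
    rw [h0, zero_pow hm.ne'] at hαm
    exact zero_ne_one hαm
  -- α^(N-1) = α^(m-1) (both are α⁻¹)
  have hαN : α ^ N = 1 := by
    obtain ⟨k, rfl⟩ := hmN
    rw [pow_mul, hαm, one_pow]
  have hinv : α ^ (N - 1) = α ^ (m - 1) := by
    apply mul_right_cancel₀ hα0
    rw [← pow_succ, ← pow_succ, Nat.sub_add_cancel hN, Nat.sub_add_cancel hm, hαN, hαm]
  -- Frobenius^j on K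
  haveI : CharP K q := charP_of_injective_algebraMap (algebraMap (ZMod q) K).injective q
  haveI : ExpChar K q := ExpChar.prime (Fact.out : q.Prime)
  let ψ : K →+* K := iterateFrobenius K q j
  have hψα : ψ α = α ^ (N - 1) := by
    show iterateFrobenius K q j α = α ^ (N - 1)
    rw [iterateFrobenius_def, ← Nat.div_add_mod (q ^ j) m, pow_add, pow_mul, hαm, one_pow, one_mul, hj, hinv]
  have hcomp : ψ.comp (algebraMap (ZMod q) K) = algebraMap (ZMod q) K := Subsingleton.elim _ _
  have hroot : h.eval₂ (algebraMap (ZMod q) K) (α ^ (N - 1)) = 0 := by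
    have e := Polynomial.hom_eval₂ h (algebraMap (ZMod q) K) ψ α
    rw [hcomp, hψα] at e
    rw [← e]
    have h0 : h.eval₂ (algebraMap (ZMod q) K) α = 0 := AdjoinRoot.eval₂_root h
    rw [h0, map_zero]
  rw [← AdjoinRoot.mk_eq_zero, ← AdjoinRoot.aeval_eq, aeval_comp, map_pow, aeval_X]
  exact hroot

end selfreciprocal

section main
open Literature.Combinatorics.Designs.GoethalsSeidel (IsHadamardMatrix)

variable {ι : Type*} [Fintype ι] [DecidableEq ι]

/-- **Even multiplicity, columns.**  For `H Hᵀ = n·1`, a prime `q` with `q ∣ n`, `q² ∤ n`, a signed automorphism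
`(π, κ, d, e)` with `κ^M = 1`, `q ∤ 2M`, and an irreducible self-reciprocal `h ∣ X^{2M} - 1` over `𝔽_q`: the kernel of
`h(Kt)` for the column pull-back `Kt` has dimension divisible by `2 · deg h`. -/
theorem hadamard_signedAut_even_multiplicity_col (H : Matrix ι ι ℤ) {n : ℤ}
    (hH : H * Hᵀ = n • (1 : Matrix ι ι ℤ)) {q : ℕ} [Fact q.Prime] (hqn : (q : ℤ) ∣ n) (hq2 : ¬ (q : ℤ) ^ 2 ∣ n)
    {π κ : Equiv.Perm ι} {d e : ι → ℤ} (hA : IsSignedAut H π κ d e) (Kt : Matrix ι ι (ZMod q))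
    (hKt : Kt = Matrix.of fun j k => if k = κ j then ((e j : ℤ) : ZMod q) else 0)
    {M : ℕ} (hM : 0 < M) (hκM : ∀ j, (κ ^ M) j = j) (hqM : ((2 * M : ℕ) : ZMod q) ≠ 0)
    {h : (ZMod q)[X]} (hirr : Irreducible h) (hdvd : h ∣ X ^ (2 * M) - 1)
    (hrec : h ∣ h.comp (X ^ (2 * M - 1))) :
    2 * h.natDegree ∣ Module.finrank (ZMod q) (LinearMap.ker (aeval (Matrix.toLinAlgEquiv' Kt) h)) := by
  set T := Matrix.toLinAlgEquiv' Kt with hT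
  have hee : ∀ j, ((e j : ℤ) : ZMod q) * ((e j : ℤ) : ZMod q) = 1 := signedAut_sign_sq hA q
  have hiso : ∀ v w, T v ⬝ᵥ T w = v ⬝ᵥ w := fun v w => by
    rw [hT, Matrix.toLinAlgEquiv'_apply, Matrix.toLinAlgEquiv'_apply]
    exact signedPullback_isometry κ _ hee Kt hKt v w
  have hTN : T ^ (2 * M) = 1 := by
    rw [hT, ← map_pow, signedPullback_pow_eq_one κ _ hee Kt hKt hκM, map_one]
  set C : Submodule (ZMod q) (ι → ZMod q) :=
    LinearMap.ker (Matrix.toLinAlgEquiv' (H.map (Int.castRingHom (ZMod q)))) with hC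
  have hmemC : ∀ v, v ∈ C ↔ H.map (Int.castRingHom (ZMod q)) *ᵥ v = 0 := fun v => by
    rw [hC, LinearMap.mem_ker, Matrix.toLinAlgEquiv'_apply]
  have hCT : ∀ v ∈ C, T v ∈ C := fun v hv => by
    rw [hmemC] at hv ⊢
    rw [hT, Matrix.toLinAlgEquiv'_apply]
    exact hadamard_code_modq_signedAut H hA Kt hKt v hv
  have hCsd : ∀ v, v ∈ C ↔ ∀ c ∈ C, v ⬝ᵥ c = 0 := fun v => by
    rw [hmemC, hadamard_code_modq_selfDual H hH hqn hq2 v]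
    exact forall_congr' fun c => by rw [hmemC]
  exact two_mul_natDegree_dvd_finrank_ker' T hiso (by omega) hqM hTN hdvd hirr hrec C hCT hCsd

/-- **Even multiplicity, rows** (the column theorem for `Hᵀ`). -/
theorem hadamard_signedAut_even_multiplicity_row (H : Matrix ι ι ℤ) {n : ℤ}
    (hH : H * Hᵀ = n • (1 : Matrix ι ι ℤ)) {q : ℕ} [Fact q.Prime] (hqn : (q : ℤ) ∣ n) (hq2 : ¬ (q : ℤ) ^ 2 ∣ n)
    {π κ : Equiv.Perm ι} {d e : ι → ℤ} (hA : IsSignedAut H π κ d e) (Pt : Matrix ι ι (ZMod q))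
    (hPt : Pt = Matrix.of fun i k => if k = π i then ((d i : ℤ) : ZMod q) else 0)
    {M : ℕ} (hM : 0 < M) (hπM : ∀ i, (π ^ M) i = i) (hqM : ((2 * M : ℕ) : ZMod q) ≠ 0)
    {h : (ZMod q)[X]} (hirr : Irreducible h) (hdvd : h ∣ X ^ (2 * M) - 1)
    (hrec : h ∣ h.comp (X ^ (2 * M - 1))) :
    2 * h.natDegree ∣ Module.finrank (ZMod q) (LinearMap.ker (aeval (Matrix.toLinAlgEquiv' Pt) h)) := by
  have hn : n ≠ 0 := by
    rintro rfl
    exact hq2 (dvd_zero _)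
  have hHt : Hᵀ * Hᵀᵀ = n • (1 : Matrix ι ι ℤ) := by
    rw [Matrix.transpose_transpose]
    exact transpose_mul_self_of_mul_transpose H n hn hH
  exact hadamard_signedAut_even_multiplicity_col Hᵀ hHt hqn hq2 (isSignedAut_transpose hA) Pt hPt hM hπM hqM hirr
    hdvd hrec

/-- **Even multiplicity, packaged (columns).**  With `m ∣ 2M`, `q^j ≡ -1 (mod m)` and `h` an irreducible factor of
`X^m - 1` over `𝔽_q` (e.g. of the cyclotomic polynomial `Φ_m`): `2 · deg h ∣ dim ker h(Kt)`. -/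
theorem hadamard_signedAut_even_multiplicity (H : Matrix ι ι ℤ) {n : ℤ}
    (hH : H * Hᵀ = n • (1 : Matrix ι ι ℤ)) {q : ℕ} [Fact q.Prime] (hqn : (q : ℤ) ∣ n) (hq2 : ¬ (q : ℤ) ^ 2 ∣ n)
    {π κ : Equiv.Perm ι} {d e : ι → ℤ} (hA : IsSignedAut H π κ d e) (Kt : Matrix ι ι (ZMod q))
    (hKt : Kt = Matrix.of fun j k => if k = κ j then ((e j : ℤ) : ZMod q) else 0)
    {M : ℕ} (hM : 0 < M) (hκM : ∀ j, (κ ^ M) j = j) (hqM : ((2 * M : ℕ) : ZMod q) ≠ 0)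
    {m j : ℕ} (hmM : m ∣ 2 * M) (hj : q ^ j % m = m - 1)
    {h : (ZMod q)[X]} (hirr : Irreducible h) (hdvd : h ∣ X ^ m - 1) :
    2 * h.natDegree ∣ Module.finrank (ZMod q) (LinearMap.ker (aeval (Matrix.toLinAlgEquiv' Kt) h)) :=
  hadamard_signedAut_even_multiplicity_col H hH hqn hq2 hA Kt hKt hM hκM hqM hirr
    (dvd_trans hdvd (X_pow_sub_one_dvd_of_dvd hmM))
    (dvd_comp_X_pow_of_selfConj_mod hmM (by omega) hj hirr hdvd)

/-- The Hadamard-matrix form at order `668 = 4·167` (`q = 167`, `q ∥ 668`), columns. -/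
theorem hadamard668_signedAut_even_multiplicity {H : Matrix ι ι ℤ} (hH : IsHadamardMatrix H)
    (hcard : Fintype.card ι = 668) {π κ : Equiv.Perm ι} {d e : ι → ℤ} (hA : IsSignedAut H π κ d e)
    (Kt : Matrix ι ι (ZMod 167)) (hKt : Kt = Matrix.of fun j k => if k = κ j then ((e j : ℤ) : ZMod 167) else 0)
    {M : ℕ} (hM : 0 < M) (hκM : ∀ j, (κ ^ M) j = j) (hqM : ((2 * M : ℕ) : ZMod 167) ≠ 0)
    {m j : ℕ} (hmM : m ∣ 2 * M) (hj : 167 ^ j % m = m - 1)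
    {h : (ZMod 167)[X]} (hirr : Irreducible h) (hdvd : h ∣ X ^ m - 1) :
    2 * h.natDegree ∣ Module.finrank (ZMod 167) (LinearMap.ker (aeval (Matrix.toLinAlgEquiv' Kt) h)) := by
  haveI : Fact (Nat.Prime 167) := ⟨by norm_num⟩
  have hH' : H * Hᵀ = (668 : ℤ) • (1 : Matrix ι ι ℤ) := by rw [hH.2, hcard]; norm_num
  exact hadamard_signedAut_even_multiplicity H hH' (by norm_num) (by norm_num) hA Kt hKt hM hκM hqM hmM hj hirr hdvd

end main

end Summit.Ventures.DiscreteObjects.Hadamard
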